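/-
Copyright (c) 2026 the pub-hodgecm-mathlib formalisation cell (harness21).  Prover seat hodgecm-mathlib-F0P2-p01 (g11), programme P2,
brick (F1) «FRAME SIGNS ⟹ Weil's majorants» of the Θ-OCC-GEN road (OCC♭-GEN line, stub `StubThetaOccursInGen`), 2026-09-01.
KERNEL module: THEOREMS ONLY (no definition, no named fact, no `sorry`, no instance, no notation).
-/
import Literature.NumberTheory.Automorphic.Liu2021.ThetaLiftFromLineMajorants   -- ★ p844187 `hasThetaMajorants_lineThetaKernelDatum` (F0P2-p06 (g8))
import HarnessLib

/-!
# Weil's majorants for the theta kernel of the line, FROM THE FRAME HYPOTHESES of the (C♯)hol ∕ OCC♭∀ ∕ Θ-OCC-GEN letters (`N = 3`):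
# `H` definite at the complex places `≠` that of `ι` and a diagonal frame `ᵗḡ H g = diag dV` ⟹ `hρ : HasThetaMajorants (ω_ψ ∘ s_pair)`

Topic `NumberTheory/Automorphic/Liu2021`; namespace `Literature.NumberTheory.Automorphic.Liu2021`.  KERNEL: theorems only.  Cell hodgecm-mathlib
FLOOR 0, programme P2, the OCC♭-GEN pay-down line of OCC♭∀ (crux H413; letter Θ-OCC-GEN `StubThetaOccursInGen` of `Cruxes/H413/Lines/F0_P2OccFlatGeneral.lean`).
★ `hasThetaMajorants_lineThetaKernelDatum` (F0P2-p06 (g8), `ThetaLiftFromLineMajorants`) discharges the T5 binder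
`hρ : HasThetaMajorants (fun p Φ ↦ pairRep … (diagonal dV) (JW a) (chiSplittingLine … (toHeckeCharacter L μ) …) p Φ)` of ★ `lineThetaKernelDatum` ∕ ★
`MeetsThetaLiftFromLine` ∕ ★ `F0P2sThetaFunIntertwiner` … from two SIGN FACTS on the diagonal frame: `h₁V` (through the distinguished embedding all but at most
one of the real numbers `ι(dV i)` share a strict sign) and `hV` (through every complex embedding off the place of `ι` all of them do).  THIS FILE derives
both from the FRAME HYPOTHESES the letters carry — `hg : ᵗḡ H g = diag dV` and `hdef : ∀ τ′, mk τ′ ≠ mk ι → (H.map τ′).PosDef` — so that `hρ` is no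
longer DATA of the Θ-OCC-GEN road:
* `re_embedding_frame_pos_of_posDef` — congruence transports definiteness through a complex embedding (`(diag dV)^τ = (g^τ)ᴴ H^τ g^τ`,
  [PlatonovRapinchuk1994, §5.3]; the argument of ★ `ThetaLiftFromLineFrame`'s private `posDef_map_diagonal_of_congr`), and a positive definite
  DIAGONAL matrix has positive entries (Mathlib `Matrix.posDef_diagonal_iff`): `0 < re τ(dV i)` for every `i`;
* (private) `exists_allButOne_sameSign_fin_three` — for THREE non-zero real numbers two share a sign (pigeonhole), which is all `h₁V` asks at `N = 3`
  (no inertia theorem is needed: `h₁V` does not require a minority sign);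
* **`hasThetaMajorants_lineThetaKernelDatum_of_frame`** — `N = 3`: `hρ` from `(hdV, hdV0, hg, hdef)` alone (the signature-`(2,1)` frame `T`, `hT` of the
  letters is not even used).
HONEST SCOPE.  Nothing of [Liu2021] is asserted; this file books nothing.  HC_CM is proved only modulo the printed citations until rung 0 closes.

## References
* [Weil1964] A. Weil, *Sur certains groupes d'opérateurs unitaires*, Acta Math. 111 (1964), Chap. III n° 41 Lemme 5 p. 194, Thm. 6 (1) p. 193.
* [PlatonovRapinchuk1994] V. Platonov, A. Rapinchuk, *Algebraic Groups and Number Theory* (1994), §5.3 (definite unitary groups at a place).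
* [Liu2021] Y. Liu, Camb. J. Math. 9 (2021) = arXiv:2102.11518, App. D §D.1 Steps 1–2 (l. 5215–5219).
* [GelbartRogawski1991] S. Gelbart, J. Rogawski, Invent. Math. 105 (1991), §3.1 Prop. 3.1.1 p. 455.
-/

set_option autoImplicit false

noncomputable section

open NumberField
open scoped Matrix ComplexOrder

namespace Literature.NumberTheory.Automorphic.Liu2021

open Literature.NumberTheory.Automorphic Literature.NumberTheory.Automorphic.UnitaryGroup
open Literature.NumberTheory.Automorphic.IdeleClassGroup
open Literature.NumberTheory.Automorphic.Liu2021.Def411WeilCarriers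
open Literature.NumberTheory.Automorphic.Liu2021.Def411WeilCarriersDoubling
open Literature.NumberTheory.GelbartRogawski1991 Literature.NumberTheory.GelbartRogawski1991.UnitaryDualPair
open Literature.NumberTheory.Weil1964
open Literature.RepresentationTheory.Liu2021

/-! ## §1 Sign facts on a diagonal frame -/

section Signs

variable (L : Type) [Field L] [NumberField L] [IsCMField L] {N : ℕ} (H : Matrix (Fin N) (Fin N) L) (dV : Fin N → L) (g : GL (Fin N) L)

/-- **Definiteness through a complex embedding forces positive frame signs.**  If `ᵗḡ H g = diag dV` over the CM field `L` and `H^τ` is positive definite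
then every `τ(dV i)` is a positive real: `(diag dV)^τ = (g^τ)ᴴ H^τ g^τ` is positive definite (congruence by an invertible matrix, Mathlib
`Matrix.IsUnit.posDef_star_left_conjugate_iff`) and diagonal (Mathlib `Matrix.posDef_diagonal_iff`). [cite: PlatonovRapinchuk1994, §5.3 Thm. 5.5] -/
theorem re_embedding_frame_pos_of_posDef
    (hg : ((g : Matrix (Fin N) (Fin N) L).map (cmConjRingHom L))ᵀ * H * (g : Matrix (Fin N) (Fin N) L) = Matrix.diagonal dV)
    (τ : L →+* ℂ) (hτ : (H.map τ).PosDef) (i : Fin N) : 0 < (τ (dV i)).re := by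
  have hU : IsUnit ((g : Matrix (Fin N) (Fin N) L).map τ) := (Units.isUnit g).map (RingHom.mapMatrix τ)
  have hstar : star ((g : Matrix (Fin N) (Fin N) L).map τ) = ((g : Matrix (Fin N) (Fin N) L).map (⇑τ ∘ ⇑(cmConjRingHom L)))ᵀ := by
    rw [Matrix.star_eq_conjTranspose, Matrix.conjTranspose, Matrix.transpose_map, Matrix.map_map]
    congr 2
    funext x
    exact (embedding_cmConjRingHom L τ x).symm
  have key : (Matrix.diagonal dV).map τ =
      star ((g : Matrix (Fin N) (Fin N) L).map τ) * H.map τ * (g : Matrix (Fin N) (Fin N) L).map τ := by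
    rw [← hg, Matrix.map_mul, Matrix.map_mul, Matrix.transpose_map, Matrix.map_map, hstar]
  have hpd : ((Matrix.diagonal dV).map τ).PosDef := by
    rw [key]
    exact (Matrix.IsUnit.posDef_star_left_conjugate_iff hU).2 hτ
  rw [Matrix.diagonal_map (map_zero τ)] at hpd
  have hi := (Matrix.posDef_diagonal_iff.1 hpd) i
  have h := (Complex.lt_def.1 hi).1
  simpa using h

/-- **Pigeonhole for three signs**: among three non-zero reals two share a strict sign, i.e. all but (at most) one of them are positive or all but
(at most) one are negative — the shape of the `h₁V` binder of ★ `hasThetaMajorants_lineThetaKernelDatum` at `N = 3`. [folklore] -/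
private theorem exists_allButOne_sameSign_fin_three (d : Fin 3 → ℝ) (hd : ∀ i, d i ≠ 0) :
    ∃ i₀ : Fin 3, (∀ i, i ≠ i₀ → 0 < d i) ∨ ∀ i, i ≠ i₀ → d i < 0 := by
  rcases lt_or_gt_of_ne (hd 0) with h0 | h0 <;> rcases lt_or_gt_of_ne (hd 1) with h1 | h1 <;>
    rcases lt_or_gt_of_ne (hd 2) with h2 | h2
  · exact ⟨0, Or.inr fun i hi => by fin_cases i <;> simp_all⟩
  · exact ⟨2, Or.inr fun i hi => by fin_cases i <;> simp_all⟩
  · exact ⟨1, Or.inr fun i hi => by fin_cases i <;> simp_all⟩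
  · exact ⟨0, Or.inl fun i hi => by fin_cases i <;> simp_all⟩
  · exact ⟨0, Or.inr fun i hi => by fin_cases i <;> simp_all⟩
  · exact ⟨1, Or.inl fun i hi => by fin_cases i <;> simp_all⟩
  · exact ⟨2, Or.inl fun i hi => by fin_cases i <;> simp_all⟩
  · exact ⟨0, Or.inl fun i hi => by fin_cases i <;> simp_all⟩

/-- The `h₁V` binder at `N = 3` through ANY complex embedding: the three `dV i ∈ L⁺` are non-zero reals through `τ` (★ `re_apply_ne_zero_of_complexConj_eq`),
so two of the `re τ(dV i)` share a sign. [folklore] -/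
private theorem exists_allButOne_sameSign_re_embedding (dV : Fin 3 → L) (hdV : ∀ i, IsCMField.complexConj L (dV i) = dV i) (hdV0 : ∀ i, dV i ≠ 0)
    (τ : L →+* ℂ) : ∃ i₀ : Fin 3, (∀ i, i ≠ i₀ → 0 < (τ (dV i)).re) ∨ ∀ i, i ≠ i₀ → (τ (dV i)).re < 0 :=
  exists_allButOne_sameSign_fin_three (fun i => (τ (dV i)).re) fun i => re_apply_ne_zero_of_complexConj_eq L τ (hdV i) (hdV0 i)

end Signs

/-! ## §2 `hρ` from the frame hypotheses of the letters (`N = 3`) -/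

section Frame

variable (L : Type) [Field L] [NumberField L] [IsCMField L] (ι : L →+* ℂ) (H : Matrix (Fin 3) (Fin 3) L)
  {n' : ℕ} (e₁ : Fin 3 × Fin 1 ≃ Fin n') (dV : Fin 3 → L) (hdV : ∀ i, IsCMField.complexConj L (dV i) = dV i)
  (hdV0 : ∀ i, dV i ≠ 0) (g : GL (Fin 3) L)

set_option maxHeartbeats 1600000 in
/-- **THE T5 BINDER `hρ` FROM THE FRAME HYPOTHESES** of (C♯)hol ∕ OCC♭∀ ∕ Θ-OCC-GEN: for a CM field `L`, `H` positive definite through every complex embedding off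
the place of `ι` (`hdef`) and a diagonal frame `ᵗḡ H g = diag dV` (`hg`; `dV i ∈ L⁺` non-zero), the Weil representation at the line's `μ`-splitting
`pairRep … (diagonal dV) (JW a) (chiSplittingLine … (toHeckeCharacter L μ) …)` `HasThetaMajorants` for EVERY conjugate-symplectic `μ` and EVERY line `a` — ★
`hasThetaMajorants_lineThetaKernelDatum` at the sign facts of §1 (`h₁V` by pigeonhole, `hV` by definiteness).  So the theta kernel datum ★
`lineThetaKernelDatum L 3 e₁ dV hdV hdV0 μ hμ a hρ` EXISTS at every frame of the letters, with no majorant hypothesis left.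
[cite: Weil1964, Chap. III n° 41 Lemme 5 p. 194, Thm. 6 (1) p. 193] [cite: Liu2021, App. D §D.1 Steps 1–2 (l. 5215–5219)] [cite: PlatonovRapinchuk1994, §5.3 Thm. 5.5] -/
theorem hasThetaMajorants_lineThetaKernelDatum_of_frame
    (hg : ((g : Matrix (Fin 3) (Fin 3) L).map (cmConjRingHom L))ᵀ * H * (g : Matrix (Fin 3) (Fin 3) L) = Matrix.diagonal dV)
    (hdef : ∀ τ' : L →+* ℂ, InfinitePlace.mk τ' ≠ InfinitePlace.mk ι → (H.map τ').PosDef)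
    (μ : Literature.NumberTheory.Automorphic.IdeleClassGroup L →ₜ* Circle) (hμ : IsConjugateSymplectic L μ) (a : (↥(maximalRealSubfield L))ˣ) :
    HasThetaMajorants fun
      (p : ↥(UnitaryGroup.adelic (↥(maximalRealSubfield L)) L (IsCMField.complexConj L) 3 (Matrix.diagonal dV)) ×
        ↥(UnitaryGroup.adelic (↥(maximalRealSubfield L)) L (IsCMField.complexConj L) 1 (JW (↥(maximalRealSubfield L)) L a)))
      (Φ : piSchwartzBruhat (↥(maximalRealSubfield L)) (Fin n')) =>
        pairRep (↥(maximalRealSubfield L)) L (IsCMField.complexConj L) 3 1 e₁ (Matrix.diagonal dV) (JW (↥(maximalRealSubfield L)) L a)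
          (chiSplittingLine L e₁ dV hdV hdV0 (toHeckeCharacter L μ) (isUnitary_toHeckeCharacter L μ)
            ((isOscillatorChar_toHeckeCharacter_iff μ).mpr hμ) (TW (↥(maximalRealSubfield L)) a)
            (isUnit_det_TW (↥(maximalRealSubfield L)) a) (JW (↥(maximalRealSubfield L)) L a) (JW_eq (↥(maximalRealSubfield L)) L a)) p Φ :=
  hasThetaMajorants_lineThetaKernelDatum L e₁ dV hdV hdV0 μ hμ a ι (exists_allButOne_sameSign_re_embedding L dV hdV hdV0 ι)
    fun τ hτ => Or.inl (re_embedding_frame_pos_of_posDef L H dV g hg τ (hdef τ hτ))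

end Frame

end Literature.NumberTheory.Automorphic.Liu2021

end
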